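import Literature.Geometry.Riemannian.MetricFlowFConvergenceWithinExists
import Literature.Geometry.Riemannian.MetricFlowCorrespondenceExtend
import HarnessLib

/-!
# 𝔽-convergence on compact time-intervals implies convergence within a correspondence on compact
# time-intervals (Bamler 2023, §6.2, Thm. 6.5)

R. Bamler, *Compactness theory of the space of super Ricci flows*, Invent. Math. 233 (2023), §6.1
Def. 6.1 (𝔽-convergence within a correspondence "on compact time-intervals": for every compact
sub-interval `I₀ ⊂ I^∞`, convergence of the restrictions within `ℭ|_{I'' ∩ I₀}` uniform over
`J ∩ I₀`) and §6.2, **Theorem 6.5** (arXiv v1 Thm. 129): if for every compact sub-interval `I₀` the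
restricted pairs `𝔽`-converge, `d^{J ∩ I₀}_𝔽(𝒳ⁱ|_{I₀}, 𝒳^∞|_{I₀}) → 0`, then there is ONE
correspondence `ℭ` between all `𝒳ⁱ`, `i ∈ ℕ ∪ {∞}`, over `I^∞` within which the convergence holds on
compact time-intervals.

We formalise the special case of the source in which all pairs live over a COMMON time set `I₀`
(the tree's `MetricFlowPair I₀` families, as in `MetricFlowPair.FConvergesWithin`; in the source the
`𝒳ⁱ` live over intervals `Iⁱ → I^∞`), and we ASSUME an exhaustion of `I₀` by an increasing sequence
of compact windows `[A k, B k] ⊆ I₀` that is cofinal among the compact intervals of `I₀` (every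
`[a, b] ⊆ I₀` lies in some `[A k, B k]`; for an interval `I₀` take `A k ↓ inf I₀`, `B k ↑ sup I₀`) —
the source's "increasing sequence of sub-intervals `I₀ⁱ ⊂ I^∞` with `⋃ᵢ I₀ⁱ = I^∞`".

* `MetricFlowPair.FConvergesWithinOn P P_∞ ℭ I₁ h₁ J` — Def. 6.1 on a window `I₁ ⊆ I₀`:
  `d^{ℭ^{n∞}|_{I₁}, J ∩ I₁}_𝔽(Pₙ|_{I₁}, P_∞|_{I₁}) → 0` (restrictions `MetricFlowPair.restrict`,
  `Correspondence₂.restrictPair`); `FConvergesWithinOnCompacts` — this for every compact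
  `[a, b] ⊆ I₀`; `FConvergesWithin.fConvergesWithinOn` — convergence within `ℭ` implies convergence
  on every measurable window (`fDistWithin_restrict_le`).
* `exists_familyCorrespondence_fConvergesWithinOnCompacts` — **Thm. 6.5**.

Proof (the source's "same construction as in the previous proof", made explicit): by the diagonal
lemma choose `κ n → ∞` with `d^{J ∩ I_{κ n}}_𝔽(Pₙ|_{I_{κ n}}, P_∞|_{I_{κ n}}) ≤ (κ n + 1)⁻¹` for
large `n` (`I_k = [A k, B k]`); pick correspondences `𝔇ⁿ` between the restricted pairs over
`I_{κ n}` with `d^{𝔇ⁿ}_𝔽 ≤ d_𝔽 + (n+1)⁻¹` (`exists_correspondence_fDistWithin_le'`), extend them to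
correspondences `ℭⁿ` between `Pₙ`, `P_∞` over `I₀` (`Correspondence₂.extend`) and wedge these along
the slices of `P_∞` (`wedgeCorrespondence`, the direct-limit construction of Thm. 6.4). For a fixed
window `W = [a, b] ⊆ I_{κ n}` (large `n`), restricting to `W` and passing to the wedge only shrinks
the integrands and the exceptional sets (`fDistWithin_restrictPair_wedgeCorrespondence_le`,
`fDistWithin_restrictPair_extend_le`), so `d^{ℭ|_W, J ∩ W}_𝔽 ≤ (κ n + 1)⁻¹ + (n + 1)⁻¹ → 0`.

## References

* R. H. Bamler, *Compactness theory of the space of super Ricci flows*, Invent. Math. 233 (2023),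
  1121–1277 (arXiv:2008.09298), §6.1 Def. 6.1; §6.2, Thm. 6.5 (arXiv v1 Thm. 129). [Bamler2023]
-/

noncomputable section

open Set MeasureTheory Filter TopologicalSpace Function
open scoped Topology ENNReal NNReal

namespace Literature.Geometry.Riemannian

universe u

namespace MetricFlowPair

open MetricFlow

variable {I₀ : Set ℝ}

/-! ### Def. 6.1 on windows -/

/-- **`𝔽`-convergence within `ℭ` on the window `I₁ ⊆ I₀`, uniform over `J`** (Bamler 2023, §6.1,
Def. 6.1 with `ℭ|_{I'' ∩ I₁}`, `J ∩ I₁` and the restricted pairs):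
`d^{ℭ^{n∞}|_{I₁}, J ∩ I₁}_𝔽(Pₙ|_{I₁}, P_∞|_{I₁}) → 0`. [cite: Bamler2023, §6.1, Def. 6.1] -/
def FConvergesWithinOn (P : ℕ → MetricFlowPair.{u} I₀) (Pinf : MetricFlowPair.{u} I₀)
    (ℭ : FamilyCorrespondence (fun o : Option ℕ ↦ (o.elim Pinf P).flow) I₀) (I₁ : Set ℝ)
    (h₁ : I₁ ⊆ I₀) (J : Set ℝ) : Prop :=
  Tendsto (fun n ↦ fDistWithin ((P n).restrict h₁) (Pinf.restrict h₁)
    ((ℭ.pair (some n) none).restrictPair h₁ h₁ h₁) (J ∩ I₁)) atTop (𝓝 0)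

/-- **`𝔽`-convergence within `ℭ` on compact time-intervals, uniform over `J`** (Bamler 2023, §6.1,
Def. 6.1): `FConvergesWithinOn` on every compact window `[a, b] ⊆ I₀`.
[cite: Bamler2023, §6.1, Def. 6.1] -/
def FConvergesWithinOnCompacts (P : ℕ → MetricFlowPair.{u} I₀) (Pinf : MetricFlowPair.{u} I₀)
    (ℭ : FamilyCorrespondence (fun o : Option ℕ ↦ (o.elim Pinf P).flow) I₀) (J : Set ℝ) : Prop :=
  ∀ (a b : ℝ) (hab : Icc a b ⊆ I₀), FConvergesWithinOn P Pinf ℭ (Icc a b) hab J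

/-- Convergence within `ℭ` (uniform over `J`) implies convergence within `ℭ` on every measurable
window (`fDistWithin_restrict_le`). [cite: Bamler2023, §6.1, Def. 6.1] -/
theorem FConvergesWithin.fConvergesWithinOn {P : ℕ → MetricFlowPair.{u} I₀}
    {Pinf : MetricFlowPair.{u} I₀}
    {ℭ : FamilyCorrespondence (fun o : Option ℕ ↦ (o.elim Pinf P).flow) I₀} {J : Set ℝ}
    (h : FConvergesWithin P Pinf ℭ J) {I₁ : Set ℝ} (hI₁ : MeasurableSet I₁) (h₁ : I₁ ⊆ I₀) :
    FConvergesWithinOn P Pinf ℭ I₁ h₁ J :=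
  tendsto_of_tendsto_of_tendsto_of_le_of_le tendsto_const_nhds h (fun _ ↦ zero_le)
    fun _ ↦ fDistWithin_restrict_le hI₁ h₁ h₁ h₁

/-- Convergence within `ℭ` (uniform over `J`) implies convergence within `ℭ` on compact
time-intervals. [cite: Bamler2023, §6.1, Def. 6.1] -/
theorem FConvergesWithin.fConvergesWithinOnCompacts {P : ℕ → MetricFlowPair.{u} I₀}
    {Pinf : MetricFlowPair.{u} I₀}
    {ℭ : FamilyCorrespondence (fun o : Option ℕ ↦ (o.elim Pinf P).flow) I₀} {J : Set ℝ}
    (h : FConvergesWithin P Pinf ℭ J) : FConvergesWithinOnCompacts P Pinf ℭ J :=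
  fun _ _ hab ↦ h.fConvergesWithinOn measurableSet_Icc hab

/-! ### Near-optimal correspondences -/

/-- **Near-optimal correspondences, no full-definedness needed**: for `ε > 0` there is a
correspondence `ℭ` over `I` with `d^{ℭ,J}_𝔽(P, Q) ≤ d^J_𝔽(P, Q) + ε` (if `d^J_𝔽 = ∞`, any
correspondence, e.g. `kuratowskiCorrespondence P Q`). [cite: Bamler2023, §5.1, Def. 5.8 (F-distance)] -/
theorem exists_correspondence_fDistWithin_le' {I : Set ℝ} (P Q : MetricFlowPair.{u} I) (J : Set ℝ)
    {ε : ℝ≥0∞} (hε : 0 < ε) :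
    ∃ ℭ : Correspondence₂ P.flow Q.flow I, fDistWithin P Q ℭ J ≤ fDist J P Q + ε := by
  by_cases htop : fDist J P Q = ⊤
  · exact ⟨kuratowskiCorrespondence P Q, by rw [htop, top_add]; exact le_top⟩
  · obtain ⟨ℭ, hℭ⟩ := iInf_lt_iff.1 (ENNReal.lt_add_right htop hε.ne')
    obtain ⟨_, hlt⟩ := iInf_lt_iff.1 hℭ
    exact ⟨ℭ, hlt.le⟩

/-! ### Restricting the wedge -/

section Wedge

variable (P : ℕ → MetricFlowPair.{u} I₀) (Pinf : MetricFlowPair.{u} I₀)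
  (ℭ : ∀ n, Correspondence₂ (P n).flow Pinf.flow I₀)

/-- **The restricted pair correspondence of the wedge is not worse than the restricted `ℭⁿ`**:
every radius admissible for `ℭⁿ|_W` is admissible for `ℭ^{n∞}|_W` with the same exceptional set
and couplings, the integrand being pointwise smaller (`kernelDistWithin_wedgeCorrespondence_le`;
restriction does not change integrands). [cite: Bamler2023, §6.2, proof of Thm. 6.5 (arXiv v1 Thm. 129)] -/
theorem fDistWithin_restrictPair_wedgeCorrespondence_le (n : ℕ) {W : Set ℝ} (hW : W ⊆ I₀)
    (J : Set ℝ) :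
    fDistWithin ((P n).restrict hW) (Pinf.restrict hW)
        (((wedgeCorrespondence P Pinf ℭ).pair (some n) none).restrictPair hW hW hW) J ≤
      fDistWithin ((P n).restrict hW) (Pinf.restrict hW) ((ℭ n).restrictPair hW hW hW) J := by
  refine le_fDistWithin_iff.2 fun r hr ↦ fDistWithin_le ?_
  obtain ⟨hr, E, hEm, hEI, hJ, hE₁, hE₂, hvol, q, hq, hint⟩ := hr
  refine ⟨hr, E, hEm, hEI, hJ, fun t ht ↦ ⟨⟨(hE₁ ht).1, (hE₂ ht).1⟩, ht.1⟩,
    fun t ht ↦ ⟨((ℭ n).dom₂_subset (hE₂ ht).1).1, ht.1⟩, hvol, q, hq, fun s hs t ht hst ↦ ?_⟩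
  exact (lintegral_mono fun p ↦ kernelDistWithin_wedgeCorrespondence_le P Pinf ℭ n (hE₁ hs).1
    (hE₂ hs).1 (hE₁ ht).1 (hE₂ ht).1 p).trans (hint s hs t ht hst)

end Wedge

end MetricFlowPair

open MetricFlow MetricFlowPair

/-- **Bamler 2023, Theorem 6.5 (arXiv v1 Thm. 129): `𝔽`-convergence on compact time-intervals
implies `𝔽`-convergence within a correspondence on compact time-intervals** — the special case of
pairs over a common time set `I₀`, exhausted by an increasing sequence of compact windows
`[A k, B k]` that is cofinal among the compact intervals of `I₀`. If for every compact interval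
`[a, b] ⊆ I₀` the restricted pairs converge, `d^{J ∩ [a,b]}_𝔽(Pₙ|_{[a,b]}, P_∞|_{[a,b]}) → 0`, then
there is ONE correspondence `ℭ` between all `Pₙ`, `n ∈ ℕ ∪ {∞}`, over `I₀` within which the
convergence holds on compact time-intervals, uniformly over `J`:
`d^{ℭ^{n∞}|_{[a,b]}, J ∩ [a,b]}_𝔽(Pₙ|_{[a,b]}, P_∞|_{[a,b]}) → 0` for every `[a, b] ⊆ I₀`. (The
source's "Moreover" clause on increasing `J_k` is not formalised.)
[cite: Bamler2023, §6.2, Thm. 6.5] -/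
theorem exists_familyCorrespondence_fConvergesWithinOnCompacts {I₀ : Set ℝ}
    (P : ℕ → MetricFlowPair.{u} I₀) (Pinf : MetricFlowPair.{u} I₀) (J : Set ℝ) (A B : ℕ → ℝ)
    (hK : ∀ k, Icc (A k) (B k) ⊆ I₀) (hmono : ∀ k, Icc (A k) (B k) ⊆ Icc (A (k + 1)) (B (k + 1)))
    (hcof : ∀ a b : ℝ, Icc a b ⊆ I₀ → ∃ k, Icc a b ⊆ Icc (A k) (B k))
    (h : ∀ (a b : ℝ) (hab : Icc a b ⊆ I₀),
      Tendsto (fun n ↦ fDist (J ∩ Icc a b) ((P n).restrict hab) (Pinf.restrict hab)) atTop (𝓝 0)) :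
    ∃ ℭ : FamilyCorrespondence (fun o : Option ℕ ↦ (o.elim Pinf P).flow) I₀,
      FConvergesWithinOnCompacts P Pinf ℭ J := by
  classical
  -- the windows `K k = [A k, B k]`, the window distances, the tolerances `(m + 1)⁻¹ → 0`
  set K : ℕ → Set ℝ := fun k ↦ Icc (A k) (B k) with hKdef
  have hKm : Monotone K := monotone_nat_of_le_succ hmono
  set d : ℕ → ℕ → ℝ≥0∞ := fun k n ↦ fDist (J ∩ K k) ((P n).restrict (hK k)) (Pinf.restrict (hK k))
    with hd
  set tol : ℕ → ℝ≥0∞ := fun m ↦ ((m + 1 : ℕ) : ℝ≥0∞)⁻¹ with htol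
  have htol0 : ∀ m, 0 < tol m := fun m ↦ ENNReal.inv_pos.2 (ENNReal.natCast_ne_top _)
  have htolt : Tendsto tol atTop (𝓝 0) :=
    ENNReal.tendsto_inv_nat_nhds_zero.comp (tendsto_add_atTop_nat 1)
  -- diagonal choice: `κ n → ∞` with `d (κ n) n ≤ (κ n + 1)⁻¹` for large `n`
  have hev : ∀ k, ∀ᶠ n in atTop, d k n ≤ tol k := fun k ↦ by
    filter_upwards [h (A k) (B k) (hK k) (Iio_mem_nhds (htol0 k))] with n hn using le_of_lt hn
  obtain ⟨κ, hκ, hκd⟩ := exists_diagonal_of_eventually hev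
  -- near-optimal window correspondences, extended to `I₀`, and their wedge
  choose 𝔇 h𝔇 using fun n ↦ exists_correspondence_fDistWithin_le' ((P n).restrict (hK (κ n)))
    (Pinf.restrict (hK (κ n))) (J ∩ K (κ n)) (htol0 n)
  refine ⟨wedgeCorrespondence P Pinf (fun n ↦ (𝔇 n).extend (hK (κ n))), fun a b hab ↦ ?_⟩
  -- a fixed window `W = [a, b] ⊆ K k₀ ⊆ K (κ n)` for large `n`
  obtain ⟨k₀, hk₀⟩ := hcof a b hab
  have hWK : ∀ᶠ n in atTop, Icc a b ⊆ K (κ n) := by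
    filter_upwards [hκ.eventually_ge_atTop k₀] with n hn using hk₀.trans (hKm hn)
  have hlim : Tendsto (fun n ↦ tol (κ n) + tol n) atTop (𝓝 0) := by
    have := (htolt.comp hκ).add htolt
    rw [add_zero] at this
    exact this
  refine tendsto_of_tendsto_of_tendsto_of_le_of_le' tendsto_const_nhds hlim
    (Eventually.of_forall fun n ↦ zero_le) ?_
  filter_upwards [hWK, hκd] with n hnW hnd
  calc fDistWithin ((P n).restrict hab) (Pinf.restrict hab)
          (((wedgeCorrespondence P Pinf (fun n ↦ (𝔇 n).extend (hK (κ n)))).pair (some n)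
            none).restrictPair hab hab hab) (J ∩ Icc a b)
      ≤ fDistWithin ((P n).restrict hab) (Pinf.restrict hab)
          (((𝔇 n).extend (hK (κ n))).restrictPair hab hab hab) (J ∩ Icc a b) :=
        fDistWithin_restrictPair_wedgeCorrespondence_le P Pinf _ n hab _
    _ ≤ fDistWithin ((P n).restrict (hK (κ n))) (Pinf.restrict (hK (κ n))) (𝔇 n) (J ∩ K (κ n)) :=
        fDistWithin_restrictPair_extend_le (hK (κ n)) (𝔇 n) hnW measurableSet_Icc hab J
    _ ≤ d (κ n) n + tol n := h𝔇 n
    _ ≤ tol (κ n) + tol n := add_le_add hnd le_rfl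

end Literature.Geometry.Riemannian

end
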